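import Mathlib
import Literature.MathematicalPhysics.MHD.CerfonFreidbergSolutions
import HarnessLib

/-!
# The up–down symmetric Cerfon–Freidberg family at `α = 0`: closed forms of `U`, `U_X`, `U_XX`, `U_Y`, `U_YY`
# (the quantities entering the boundary constraints (6.155)), proved

For `U = cfSolution 0 c = X⁴/8 + Σ_{j=0}^{6} c_j U_j` (Freidberg 2014 (6.151)/(6.153) with `α = 0`) every slice
`X ↦ U(X, Y)` is `P(X) + Q(X)·ln X` with even sextics `P, Q` (`Q` without constant term) whose coefficients are
explicit in `(c, Y)`, and every slice `Y ↦ U(X, Y)` is an even sextic in `Y` with coefficients explicit in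
`(c, X, ln X)`.  This file proves these normal forms and, from them, the closed forms of the tree's partials
`GradShafranov.dR / dRR / dZ / dZZ` of `U` at every point with `X ≠ 0` (resp. `X > 0` for `dRR`) — the
ingredients of the boundary-fit functionals (6.155) (`IsBoundaryFitGeom`).  Pure calculus; consumed by the
kernel existence/uniqueness certificate of the ITER-like instance (`Models/CerfonFreidbergIterLikeKrawczyk.lean`).
Typer/prover: gridfusion-model-5 (g4), 2026-08-27.
-/

noncomputable section

namespace Literature.MathematicalPhysics.MHD.CerfonFreidberg

open GradShafranov _root_.Real Filter Topology

/-! ## Private calculus: `P(x) + Q(x)·ln x` with even sextics, and even sextics in `y` -/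

/-- Clean power rules (no `n - 1` in the exponent). [folklore] -/
private theorem hasDerivAt_sq' (x : ℝ) : HasDerivAt (fun x : ℝ => x ^ 2) (2 * x) x := by
  simpa using hasDerivAt_pow 2 x
/-- `d/dx x³ = 3x²`. [folklore] -/
private theorem hasDerivAt_cube' (x : ℝ) : HasDerivAt (fun x : ℝ => x ^ 3) (3 * x ^ 2) x := by
  simpa using hasDerivAt_pow 3 x
/-- `d/dx x⁴ = 4x³`. [folklore] -/
private theorem hasDerivAt_pow4' (x : ℝ) : HasDerivAt (fun x : ℝ => x ^ 4) (4 * x ^ 3) x := by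
  simpa using hasDerivAt_pow 4 x
/-- `d/dx x⁵ = 5x⁴`. [folklore] -/
private theorem hasDerivAt_pow5' (x : ℝ) : HasDerivAt (fun x : ℝ => x ^ 5) (5 * x ^ 4) x := by
  simpa using hasDerivAt_pow 5 x
/-- `d/dx x⁶ = 6x⁵`. [folklore] -/
private theorem hasDerivAt_pow6' (x : ℝ) : HasDerivAt (fun x : ℝ => x ^ 6) (6 * x ^ 5) x := by
  simpa using hasDerivAt_pow 6 x

/-- `iteratedDeriv 2 = deriv ∘ deriv`. [folklore] -/
private theorem iteratedDeriv_two' (f : ℝ → ℝ) : iteratedDeriv 2 f = deriv (deriv f) := by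
  rw [show (2 : ℕ) = 1 + 1 from rfl, iteratedDeriv_succ, iteratedDeriv_one]

/-- First derivative of `p₀ + p₂x² + p₄x⁴ + p₆x⁶ + (q₂x² + q₄x⁴ + q₆x⁶)·ln x` at `x ≠ 0`. [folklore] -/
private theorem hasDerivAt_PL {p₀ p₂ p₄ p₆ q₂ q₄ q₆ x : ℝ} (hx : x ≠ 0) :
    HasDerivAt (fun x => p₀ + p₂ * x ^ 2 + p₄ * x ^ 4 + p₆ * x ^ 6 + (q₂ * x ^ 2 + q₄ * x ^ 4 + q₆ * x ^ 6) * Real.log x)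
      (2 * p₂ * x + 4 * p₄ * x ^ 3 + 6 * p₆ * x ^ 5
        + (2 * q₂ * x + 4 * q₄ * x ^ 3 + 6 * q₆ * x ^ 5) * Real.log x + (q₂ * x + q₄ * x ^ 3 + q₆ * x ^ 5)) x := by
  have hP : HasDerivAt (fun x => p₀ + p₂ * x ^ 2 + p₄ * x ^ 4 + p₆ * x ^ 6)
      (0 + p₂ * (2 * x) + p₄ * (4 * x ^ 3) + p₆ * (6 * x ^ 5)) x :=
    (((hasDerivAt_const x p₀).add ((hasDerivAt_sq' x).const_mul p₂)).add
      ((hasDerivAt_pow4' x).const_mul p₄)).add ((hasDerivAt_pow6' x).const_mul p₆)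
  have hQ : HasDerivAt (fun x => q₂ * x ^ 2 + q₄ * x ^ 4 + q₆ * x ^ 6)
      (q₂ * (2 * x) + q₄ * (4 * x ^ 3) + q₆ * (6 * x ^ 5)) x :=
    (((hasDerivAt_sq' x).const_mul q₂).add ((hasDerivAt_pow4' x).const_mul q₄)).add
      ((hasDerivAt_pow6' x).const_mul q₆)
  have h := hP.add (hQ.mul (Real.hasDerivAt_log hx))
  refine h.congr_deriv ?_
  field_simp
  ring

/-- Second derivative: the derivative of the first-derivative expression at `x ≠ 0`. [folklore] -/
private theorem hasDerivAt_PL' {p₂ p₄ p₆ q₂ q₄ q₆ x : ℝ} (hx : x ≠ 0) :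
    HasDerivAt (fun x => 2 * p₂ * x + 4 * p₄ * x ^ 3 + 6 * p₆ * x ^ 5
        + (2 * q₂ * x + 4 * q₄ * x ^ 3 + 6 * q₆ * x ^ 5) * Real.log x + (q₂ * x + q₄ * x ^ 3 + q₆ * x ^ 5))
      (2 * p₂ + 12 * p₄ * x ^ 2 + 30 * p₆ * x ^ 4
        + (2 * q₂ + 12 * q₄ * x ^ 2 + 30 * q₆ * x ^ 4) * Real.log x + (3 * q₂ + 7 * q₄ * x ^ 2 + 11 * q₆ * x ^ 4)) x := by
  have hA : HasDerivAt (fun x => 2 * p₂ * x + 4 * p₄ * x ^ 3 + 6 * p₆ * x ^ 5)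
      (2 * p₂ * 1 + 4 * p₄ * (3 * x ^ 2) + 6 * p₆ * (5 * x ^ 4)) x :=
    (((hasDerivAt_id' x).const_mul (2 * p₂)).add ((hasDerivAt_cube' x).const_mul (4 * p₄))).add
      ((hasDerivAt_pow5' x).const_mul (6 * p₆))
  have hB : HasDerivAt (fun x => 2 * q₂ * x + 4 * q₄ * x ^ 3 + 6 * q₆ * x ^ 5)
      (2 * q₂ * 1 + 4 * q₄ * (3 * x ^ 2) + 6 * q₆ * (5 * x ^ 4)) x :=
    (((hasDerivAt_id' x).const_mul (2 * q₂)).add ((hasDerivAt_cube' x).const_mul (4 * q₄))).add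
      ((hasDerivAt_pow5' x).const_mul (6 * q₆))
  have hC : HasDerivAt (fun x => q₂ * x + q₄ * x ^ 3 + q₆ * x ^ 5)
      (q₂ * 1 + q₄ * (3 * x ^ 2) + q₆ * (5 * x ^ 4)) x :=
    (((hasDerivAt_id' x).const_mul q₂).add ((hasDerivAt_cube' x).const_mul q₄)).add
      ((hasDerivAt_pow5' x).const_mul q₆)
  have h := (hA.add (hB.mul (Real.hasDerivAt_log hx))).add hC
  refine h.congr_deriv ?_
  field_simp
  ring

/-- Derivative of an even sextic in `y`. [folklore] -/
private theorem hasDerivAt_evenY (g₀ g₂ g₄ g₆ y : ℝ) :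
    HasDerivAt (fun y => g₀ + g₂ * y ^ 2 + g₄ * y ^ 4 + g₆ * y ^ 6) (2 * g₂ * y + 4 * g₄ * y ^ 3 + 6 * g₆ * y ^ 5) y := by
  have h : HasDerivAt (fun y => g₀ + g₂ * y ^ 2 + g₄ * y ^ 4 + g₆ * y ^ 6)
      (0 + g₂ * (2 * y) + g₄ * (4 * y ^ 3) + g₆ * (6 * y ^ 5)) y :=
    (((hasDerivAt_const y g₀).add ((hasDerivAt_sq' y).const_mul g₂)).add
      ((hasDerivAt_pow4' y).const_mul g₄)).add ((hasDerivAt_pow6' y).const_mul g₆)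
  exact h.congr_deriv (by ring)

/-- Derivative of the derivative of an even sextic in `y`. [folklore] -/
private theorem hasDerivAt_evenY' (g₂ g₄ g₆ y : ℝ) :
    HasDerivAt (fun y => 2 * g₂ * y + 4 * g₄ * y ^ 3 + 6 * g₆ * y ^ 5) (2 * g₂ + 12 * g₄ * y ^ 2 + 30 * g₆ * y ^ 4) y := by
  have h : HasDerivAt (fun y => 2 * g₂ * y + 4 * g₄ * y ^ 3 + 6 * g₆ * y ^ 5)
      (2 * g₂ * 1 + 4 * g₄ * (3 * y ^ 2) + 6 * g₆ * (5 * y ^ 4)) y :=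
    (((hasDerivAt_id' y).const_mul (2 * g₂)).add ((hasDerivAt_cube' y).const_mul (4 * g₄))).add
      ((hasDerivAt_pow5' y).const_mul (6 * g₆))
  exact h.congr_deriv (by ring)

/-! ## Normal forms of the `α = 0` family -/

/-- `P`-coefficients of the radial slice (functions of `c` and `Y`). [cite: Freidberg2014, §6.6.1 eq. (6.153)] -/
def radP₀ (c : Fin 7 → ℝ) (Y : ℝ) : ℝ := c 0 + c 2 * Y ^ 2 + 2 * c 4 * Y ^ 4 + 8 * c 6 * Y ^ 6
/-- see `radP₀`. [cite: Freidberg2014, §6.6.1 eq. (6.153)] -/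
def radP₂ (c : Fin 7 → ℝ) (Y : ℝ) : ℝ := c 1 - 4 * c 3 * Y ^ 2 - 9 * c 4 * Y ^ 2 + 8 * c 5 * Y ^ 4 - 140 * c 6 * Y ^ 4
/-- see `radP₀`. [cite: Freidberg2014, §6.6.1 eq. (6.153)] -/
def radP₄ (c : Fin 7 → ℝ) (Y : ℝ) : ℝ := 1 / 8 + c 3 - 12 * c 5 * Y ^ 2 + 75 * c 6 * Y ^ 2
/-- see `radP₀`. [cite: Freidberg2014, §6.6.1 eq. (6.153)] -/
def radP₆ (c : Fin 7 → ℝ) (_Y : ℝ) : ℝ := c 5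
/-- `Q`-coefficients (the `ln X` part) of the radial slice. [cite: Freidberg2014, §6.6.1 eq. (6.153)] -/
def radQ₂ (c : Fin 7 → ℝ) (Y : ℝ) : ℝ := -c 2 - 12 * c 4 * Y ^ 2 - 120 * c 6 * Y ^ 4
/-- see `radQ₂`. [cite: Freidberg2014, §6.6.1 eq. (6.153)] -/
def radQ₄ (c : Fin 7 → ℝ) (Y : ℝ) : ℝ := 3 * c 4 + 180 * c 6 * Y ^ 2
/-- see `radQ₂`. [cite: Freidberg2014, §6.6.1 eq. (6.153)] -/
def radQ₆ (c : Fin 7 → ℝ) (_Y : ℝ) : ℝ := -15 * c 6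

/-- **Radial normal form:** `X ↦ U(X, Y) = P(X) + Q(X)·ln X` with the even sextics above (`α = 0`).
[cite: Freidberg2014, §6.6.1 eq. (6.153)] -/
theorem cfSolution_zero_radial (c : Fin 7 → ℝ) (Y : ℝ) :
    (fun X => cfSolution 0 c X Y) = fun X =>
      radP₀ c Y + radP₂ c Y * X ^ 2 + radP₄ c Y * X ^ 4 + radP₆ c Y * X ^ 6
        + (radQ₂ c Y * X ^ 2 + radQ₄ c Y * X ^ 4 + radQ₆ c Y * X ^ 6) * Real.log X := by
  funext X
  simp only [cfSolution, UP, U0, U1, U2, U3, U4, U5, U6, radP₀, radP₂, radP₄, radP₆, radQ₂, radQ₄, radQ₆]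
  ring

/-- Coefficients of the vertical slice (functions of `c`, `X`, `ln X`). [cite: Freidberg2014, §6.6.1 eq. (6.153)] -/
def vertG₀ (c : Fin 7 → ℝ) (X : ℝ) : ℝ :=
  X ^ 4 / 8 + c 0 + c 1 * X ^ 2 - c 2 * X ^ 2 * Real.log X + c 3 * X ^ 4 + 3 * c 4 * X ^ 4 * Real.log X
    + c 5 * X ^ 6 - 15 * c 6 * X ^ 6 * Real.log X
/-- see `vertG₀`. [cite: Freidberg2014, §6.6.1 eq. (6.153)] -/
def vertG₂ (c : Fin 7 → ℝ) (X : ℝ) : ℝ :=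
  c 2 - 4 * c 3 * X ^ 2 - 9 * c 4 * X ^ 2 - 12 * c 4 * X ^ 2 * Real.log X - 12 * c 5 * X ^ 4
    + 75 * c 6 * X ^ 4 + 180 * c 6 * X ^ 4 * Real.log X
/-- see `vertG₀`. [cite: Freidberg2014, §6.6.1 eq. (6.153)] -/
def vertG₄ (c : Fin 7 → ℝ) (X : ℝ) : ℝ := 2 * c 4 + 8 * c 5 * X ^ 2 - 140 * c 6 * X ^ 2 - 120 * c 6 * X ^ 2 * Real.log X
/-- see `vertG₀`. [cite: Freidberg2014, §6.6.1 eq. (6.153)] -/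
def vertG₆ (c : Fin 7 → ℝ) (_X : ℝ) : ℝ := 8 * c 6

/-- **Vertical normal form:** `Y ↦ U(X, Y)` is the even sextic with the coefficients above (`α = 0`).
[cite: Freidberg2014, §6.6.1 eq. (6.153)] -/
theorem cfSolution_zero_vertical (c : Fin 7 → ℝ) (X : ℝ) :
    (fun Y => cfSolution 0 c X Y) = fun Y =>
      vertG₀ c X + vertG₂ c X * Y ^ 2 + vertG₄ c X * Y ^ 4 + vertG₆ c X * Y ^ 6 := by
  funext Y
  simp only [cfSolution, UP, U0, U1, U2, U3, U4, U5, U6, vertG₀, vertG₂, vertG₄, vertG₆]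
  ring

/-! ## The partials of the `α = 0` family in closed form -/

/-- `U_X(X, Y)` for `X ≠ 0`. [cite: Freidberg2014, §6.6.1 eq. (6.155)] -/
theorem dR_cfSolution_zero (c : Fin 7 → ℝ) {X : ℝ} (hX : X ≠ 0) (Y : ℝ) :
    dR (cfSolution 0 c) X Y
      = 2 * radP₂ c Y * X + 4 * radP₄ c Y * X ^ 3 + 6 * radP₆ c Y * X ^ 5
        + (2 * radQ₂ c Y * X + 4 * radQ₄ c Y * X ^ 3 + 6 * radQ₆ c Y * X ^ 5) * Real.log X
        + (radQ₂ c Y * X + radQ₄ c Y * X ^ 3 + radQ₆ c Y * X ^ 5) := by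
  unfold dR
  rw [cfSolution_zero_radial c Y]
  exact (hasDerivAt_PL hX).deriv

/-- `U_XX(X, Y)` for `X ≠ 0` (second derivative through an eventual equality of first derivatives near `X`).
[cite: Freidberg2014, §6.6.1 eq. (6.155)] -/
theorem dRR_cfSolution_zero (c : Fin 7 → ℝ) {X : ℝ} (hX : X ≠ 0) (Y : ℝ) :
    dRR (cfSolution 0 c) X Y
      = 2 * radP₂ c Y + 12 * radP₄ c Y * X ^ 2 + 30 * radP₆ c Y * X ^ 4
        + (2 * radQ₂ c Y + 12 * radQ₄ c Y * X ^ 2 + 30 * radQ₆ c Y * X ^ 4) * Real.log X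
        + (3 * radQ₂ c Y + 7 * radQ₄ c Y * X ^ 2 + 11 * radQ₆ c Y * X ^ 4) := by
  unfold dRR
  rw [iteratedDeriv_two', cfSolution_zero_radial c Y]
  have hev : deriv (fun X => radP₀ c Y + radP₂ c Y * X ^ 2 + radP₄ c Y * X ^ 4 + radP₆ c Y * X ^ 6
        + (radQ₂ c Y * X ^ 2 + radQ₄ c Y * X ^ 4 + radQ₆ c Y * X ^ 6) * Real.log X)
      =ᶠ[𝓝 X] fun X => 2 * radP₂ c Y * X + 4 * radP₄ c Y * X ^ 3 + 6 * radP₆ c Y * X ^ 5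
        + (2 * radQ₂ c Y * X + 4 * radQ₄ c Y * X ^ 3 + 6 * radQ₆ c Y * X ^ 5) * Real.log X
        + (radQ₂ c Y * X + radQ₄ c Y * X ^ 3 + radQ₆ c Y * X ^ 5) := by
    filter_upwards [isOpen_ne.mem_nhds hX] with x hx
    exact (hasDerivAt_PL hx).deriv
  rw [hev.deriv_eq]
  exact (hasDerivAt_PL' hX).deriv

/-- `U_Y(X, Y)`. [cite: Freidberg2014, §6.6.1 eq. (6.155)] -/
theorem dZ_cfSolution_zero (c : Fin 7 → ℝ) (X Y : ℝ) :
    dZ (cfSolution 0 c) X Y = 2 * vertG₂ c X * Y + 4 * vertG₄ c X * Y ^ 3 + 6 * vertG₆ c X * Y ^ 5 := by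
  unfold dZ
  have e : cfSolution 0 c X = fun Y => cfSolution 0 c X Y := rfl
  rw [e, cfSolution_zero_vertical c X]
  exact (hasDerivAt_evenY _ _ _ _ Y).deriv

/-- `U_YY(X, Y)`. [cite: Freidberg2014, §6.6.1 eq. (6.155)] -/
theorem dZZ_cfSolution_zero (c : Fin 7 → ℝ) (X Y : ℝ) :
    dZZ (cfSolution 0 c) X Y = 2 * vertG₂ c X + 12 * vertG₄ c X * Y ^ 2 + 30 * vertG₆ c X * Y ^ 4 := by
  unfold dZZ
  have e : cfSolution 0 c X = fun Y => cfSolution 0 c X Y := rfl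
  rw [iteratedDeriv_two', e, cfSolution_zero_vertical c X]
  have hfun : deriv (fun Y => vertG₀ c X + vertG₂ c X * Y ^ 2 + vertG₄ c X * Y ^ 4 + vertG₆ c X * Y ^ 6)
      = fun Y => 2 * vertG₂ c X * Y + 4 * vertG₄ c X * Y ^ 3 + 6 * vertG₆ c X * Y ^ 5 :=
    funext fun Y => (hasDerivAt_evenY _ _ _ _ Y).deriv
  rw [hfun]
  exact (hasDerivAt_evenY' _ _ _ Y).deriv

end Literature.MathematicalPhysics.MHD.CerfonFreidberg

/-! ## Third radial derivative of the `α = 0` family (near-axis jets `U_XXX`) — appended 2026-08-27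
(gridfusion-model-5 g5; consumed by the kernel on-axis certificate `Models/CerfonFreidbergIterLikeAxis.lean`) -/

namespace Literature.MathematicalPhysics.MHD.CerfonFreidberg

open GradShafranov _root_.Real Filter Topology

/-- Derivative of the second-derivative expression `2p₂ + 12p₄x² + 30p₆x⁴ + (2q₂ + 12q₄x² + 30q₆x⁴)·ln x
+ (3q₂ + 7q₄x² + 11q₆x⁴)` at `x ≠ 0`. [folklore] -/
private theorem hasDerivAt_PL'' {p₂ p₄ p₆ q₂ q₄ q₆ x : ℝ} (hx : x ≠ 0) :
    HasDerivAt (fun x => 2 * p₂ + 12 * p₄ * x ^ 2 + 30 * p₆ * x ^ 4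
        + (2 * q₂ + 12 * q₄ * x ^ 2 + 30 * q₆ * x ^ 4) * Real.log x + (3 * q₂ + 7 * q₄ * x ^ 2 + 11 * q₆ * x ^ 4))
      (24 * p₄ * x + 120 * p₆ * x ^ 3 + (24 * q₄ * x + 120 * q₆ * x ^ 3) * Real.log x
        + (2 * q₂ + 12 * q₄ * x ^ 2 + 30 * q₆ * x ^ 4) / x + (14 * q₄ * x + 44 * q₆ * x ^ 3)) x := by
  have hA : HasDerivAt (fun x => 2 * p₂ + 12 * p₄ * x ^ 2 + 30 * p₆ * x ^ 4)
      (0 + 12 * p₄ * (2 * x) + 30 * p₆ * (4 * x ^ 3)) x :=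
    ((hasDerivAt_const x (2 * p₂)).add ((hasDerivAt_sq' x).const_mul (12 * p₄))).add
      ((hasDerivAt_pow4' x).const_mul (30 * p₆))
  have hB : HasDerivAt (fun x => 2 * q₂ + 12 * q₄ * x ^ 2 + 30 * q₆ * x ^ 4)
      (0 + 12 * q₄ * (2 * x) + 30 * q₆ * (4 * x ^ 3)) x :=
    ((hasDerivAt_const x (2 * q₂)).add ((hasDerivAt_sq' x).const_mul (12 * q₄))).add
      ((hasDerivAt_pow4' x).const_mul (30 * q₆))
  have hC : HasDerivAt (fun x => 3 * q₂ + 7 * q₄ * x ^ 2 + 11 * q₆ * x ^ 4)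
      (0 + 7 * q₄ * (2 * x) + 11 * q₆ * (4 * x ^ 3)) x :=
    ((hasDerivAt_const x (3 * q₂)).add ((hasDerivAt_sq' x).const_mul (7 * q₄))).add
      ((hasDerivAt_pow4' x).const_mul (11 * q₆))
  have h := (hA.add (hB.mul (Real.hasDerivAt_log hx))).add hC
  refine h.congr_deriv ?_
  field_simp
  ring

/-- `iteratedDeriv 3 = deriv ∘ iteratedDeriv 2`. [folklore] -/
private theorem iteratedDeriv_three' (f : ℝ → ℝ) : iteratedDeriv 3 f = deriv (iteratedDeriv 2 f) := by
  rw [show (3 : ℕ) = 2 + 1 from rfl, iteratedDeriv_succ]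

/-- **`U_XXX(X, Y)` for `X ≠ 0`** — the third radial derivative of the `α = 0` family (the cubic axis jet
entering the near-axis shift `S = −R_aΨ_RRR/(6Ψ_RR)`): the derivative of the closed form of `U_XX`
(`dRR_cfSolution_zero`, an eventual equality near `X`).  Stated for `iteratedDeriv 3` (= the tree's
`FluxGeometry.dRRR` by `rfl`). [cite: Freidberg2014, §6.6.1 eq. (6.153)] -/
theorem iteratedDeriv_three_cfSolution_zero (c : Fin 7 → ℝ) {X : ℝ} (hX : X ≠ 0) (Y : ℝ) :
    iteratedDeriv 3 (fun r => cfSolution 0 c r Y) X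
      = 24 * radP₄ c Y * X + 120 * radP₆ c Y * X ^ 3
        + (24 * radQ₄ c Y * X + 120 * radQ₆ c Y * X ^ 3) * Real.log X
        + (2 * radQ₂ c Y + 12 * radQ₄ c Y * X ^ 2 + 30 * radQ₆ c Y * X ^ 4) / X
        + (14 * radQ₄ c Y * X + 44 * radQ₆ c Y * X ^ 3) := by
  rw [iteratedDeriv_three']
  have hev : iteratedDeriv 2 (fun r => cfSolution 0 c r Y) =ᶠ[𝓝 X] fun x =>
      2 * radP₂ c Y + 12 * radP₄ c Y * x ^ 2 + 30 * radP₆ c Y * x ^ 4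
        + (2 * radQ₂ c Y + 12 * radQ₄ c Y * x ^ 2 + 30 * radQ₆ c Y * x ^ 4) * Real.log x
        + (3 * radQ₂ c Y + 7 * radQ₄ c Y * x ^ 2 + 11 * radQ₆ c Y * x ^ 4) := by
    filter_upwards [isOpen_ne.mem_nhds hX] with x hx
    exact dRR_cfSolution_zero c hx Y
  rw [hev.deriv_eq]
  exact (hasDerivAt_PL'' hX).deriv

/-- On the midplane `Y = 0` the vertical derivative of every member vanishes (up–down symmetry):
`U_Y(X, 0) = 0`. [cite: Freidberg2014, §6.6.1 eq. (6.153)] -/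
theorem dZ_cfSolution_zero_midplane (c : Fin 7 → ℝ) (X : ℝ) : dZ (cfSolution 0 c) X 0 = 0 := by
  rw [dZ_cfSolution_zero]
  ring

end Literature.MathematicalPhysics.MHD.CerfonFreidberg

/-! ## The mixed jet `U_XYY` and the Grad–Shafranov identities in closed form — appended 2026-08-27
(gridfusion-model-5 g5; inputs of the near-axis triangularity / Bateman (7.3.5) consistency on the CF rung) -/

namespace Literature.MathematicalPhysics.MHD.CerfonFreidberg

open GradShafranov _root_.Real Filter Topology

/-- `d/dX vertG₂(c, X)` for `X ≠ 0`. [folklore] -/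
private theorem hasDerivAt_vertG₂ (c : Fin 7 → ℝ) {X : ℝ} (hX : X ≠ 0) :
    HasDerivAt (fun X => vertG₂ c X)
      (-8 * c 3 * X - 30 * c 4 * X - 24 * c 4 * X * Real.log X - 48 * c 5 * X ^ 3 + 480 * c 6 * X ^ 3
        + 720 * c 6 * X ^ 3 * Real.log X) X := by
  unfold vertG₂
  have hl := Real.hasDerivAt_log hX
  have h2 := hasDerivAt_sq' X
  have h4 := hasDerivAt_pow4' X
  have h : HasDerivAt (fun X => c 2 - 4 * c 3 * X ^ 2 - 9 * c 4 * X ^ 2 - 12 * c 4 * X ^ 2 * Real.log X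
      - 12 * c 5 * X ^ 4 + 75 * c 6 * X ^ 4 + 180 * c 6 * X ^ 4 * Real.log X)
      (0 - 4 * c 3 * (2 * X) - 9 * c 4 * (2 * X) - (12 * c 4 * (2 * X) * Real.log X + 12 * c 4 * X ^ 2 * X⁻¹)
        - 12 * c 5 * (4 * X ^ 3) + 75 * c 6 * (4 * X ^ 3)
        + (180 * c 6 * (4 * X ^ 3) * Real.log X + 180 * c 6 * X ^ 4 * X⁻¹)) X := by
    refine ((((((hasDerivAt_const X (c 2)).sub (h2.const_mul (4 * c 3))).sub (h2.const_mul (9 * c 4))).sub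
      ((h2.const_mul (12 * c 4)).mul hl)).sub (h4.const_mul (12 * c 5))).add (h4.const_mul (75 * c 6))).add
      ((h4.const_mul (180 * c 6)).mul hl)
  refine h.congr_deriv ?_
  field_simp
  ring

/-- `d/dX vertG₄(c, X)` for `X ≠ 0`. [folklore] -/
private theorem hasDerivAt_vertG₄ (c : Fin 7 → ℝ) {X : ℝ} (hX : X ≠ 0) :
    HasDerivAt (fun X => vertG₄ c X) (16 * c 5 * X - 400 * c 6 * X - 240 * c 6 * X * Real.log X) X := by
  unfold vertG₄
  have hl := Real.hasDerivAt_log hX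
  have h2 := hasDerivAt_sq' X
  have h : HasDerivAt (fun X => 2 * c 4 + 8 * c 5 * X ^ 2 - 140 * c 6 * X ^ 2 - 120 * c 6 * X ^ 2 * Real.log X)
      (0 + 8 * c 5 * (2 * X) - 140 * c 6 * (2 * X) - (120 * c 6 * (2 * X) * Real.log X + 120 * c 6 * X ^ 2 * X⁻¹)) X :=
    (((hasDerivAt_const X (2 * c 4)).add (h2.const_mul (8 * c 5))).sub (h2.const_mul (140 * c 6))).sub
      ((h2.const_mul (120 * c 6)).mul hl)
  refine h.congr_deriv ?_
  field_simp
  ring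

/-- **`U_XYY(X, Y)` for `X ≠ 0`** — the mixed cubic jet (entering the near-axis triangularity
`Δ = R_aΨ_RZZ/(2eΨ_ZZ) + S/e`): the `X`-derivative of the closed form of `U_YY` (`dZZ_cfSolution_zero`).  Stated for
`deriv (fun r => dZZ U r Y)` (= the tree's `FluxGeometry.dRZZ` by `rfl`). [cite: Freidberg2014, §6.6.1 eq. (6.153)] -/
theorem deriv_dZZ_cfSolution_zero (c : Fin 7 → ℝ) {X : ℝ} (hX : X ≠ 0) (Y : ℝ) :
    deriv (fun r => dZZ (cfSolution 0 c) r Y) X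
      = 2 * (-8 * c 3 * X - 30 * c 4 * X - 24 * c 4 * X * Real.log X - 48 * c 5 * X ^ 3 + 480 * c 6 * X ^ 3
          + 720 * c 6 * X ^ 3 * Real.log X)
        + 12 * (16 * c 5 * X - 400 * c 6 * X - 240 * c 6 * X * Real.log X) * Y ^ 2 := by
  have e : (fun r => dZZ (cfSolution 0 c) r Y)
      = fun r => 2 * vertG₂ c r + 12 * vertG₄ c r * Y ^ 2 + 30 * vertG₆ c r * Y ^ 4 :=
    funext fun r => dZZ_cfSolution_zero c r Y
  rw [e]
  have h6 : HasDerivAt (fun r => 30 * vertG₆ c r * Y ^ 4) 0 X := by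
    unfold vertG₆; exact hasDerivAt_const _ _
  have h : HasDerivAt (fun r => 2 * vertG₂ c r + 12 * vertG₄ c r * Y ^ 2 + 30 * vertG₆ c r * Y ^ 4)
      (2 * (-8 * c 3 * X - 30 * c 4 * X - 24 * c 4 * X * Real.log X - 48 * c 5 * X ^ 3 + 480 * c 6 * X ^ 3
          + 720 * c 6 * X ^ 3 * Real.log X)
        + 12 * (16 * c 5 * X - 400 * c 6 * X - 240 * c 6 * X * Real.log X) * Y ^ 2 + 0) X :=
    (((hasDerivAt_vertG₂ c hX).const_mul 2).add
      (((hasDerivAt_vertG₄ c hX).const_mul 12).mul_const (Y ^ 2))).add h6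
  rw [h.deriv]
  ring

/-- **The Grad–Shafranov equation in expanded closed form:** `U_XX − U_X/X + U_YY = X²` at every point with `X ≠ 0`
(α = 0: `Δ*U = X²`; a `ring` identity of the closed forms — independent check of `dR/dRR/dZZ_cfSolution_zero`).
[cite: Freidberg2014, §6.6.1 eq. (6.150)] -/
theorem gs_expanded_cfSolution_zero (c : Fin 7 → ℝ) {X : ℝ} (hX : X ≠ 0) (Y : ℝ) :
    dRR (cfSolution 0 c) X Y - dR (cfSolution 0 c) X Y / X + dZZ (cfSolution 0 c) X Y = X ^ 2 := by
  rw [dRR_cfSolution_zero c hX, dR_cfSolution_zero c hX, dZZ_cfSolution_zero]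
  simp only [radP₂, radP₄, radP₆, radQ₂, radQ₄, radQ₆, vertG₂, vertG₄, vertG₆]
  field_simp
  ring

/-- **The `X`-derivative of the Grad–Shafranov equation in closed form:** `U_XXX − U_XX/X + U_X/X² + U_XYY = 2X`
at every point with `X ≠ 0` (differentiate `U_XX − U_X/X + U_YY = X²`; here a `ring` identity of the closed forms).
At the magnetic axis (`U_X = 0`) it is the third-order relation behind Bateman's (7.3.5). [cite: Freidberg2014, §6.6.1 eq. (6.150)] -/
theorem gs_deriv_cfSolution_zero (c : Fin 7 → ℝ) {X : ℝ} (hX : X ≠ 0) (Y : ℝ) :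
    iteratedDeriv 3 (fun r => cfSolution 0 c r Y) X - dRR (cfSolution 0 c) X Y / X
        + dR (cfSolution 0 c) X Y / X ^ 2 + deriv (fun r => dZZ (cfSolution 0 c) r Y) X = 2 * X := by
  rw [iteratedDeriv_three_cfSolution_zero c hX, dRR_cfSolution_zero c hX, dR_cfSolution_zero c hX,
    deriv_dZZ_cfSolution_zero c hX]
  simp only [radP₂, radP₄, radP₆, radQ₂, radQ₄, radQ₆]
  field_simp
  ring

end Literature.MathematicalPhysics.MHD.CerfonFreidberg
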